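import Literature.Computability.Complexity.Circuit
import Literature.Computability.Complexity.CircuitComposition
import Literature.Computability.Complexity.NegationElimination
import Literature.Computability.Complexity.NegationLimitedProofs
import HarnessLib

/-!
# Batcher's odd–even merging network (Batcher 1968; Wegener 1987, Ch. 6, §2)

Batcher's recursive *odd–even merge* (Wegener 1987, Ch. 6, Algorithm 2.1.b): to merge two sorted
lists `a₁ ≤ … ≤ a_m` and `b₁ ≤ … ≤ b_m` (`m = 2^r`), merge the odd-indexed and the even-indexed
subsequences recursively into `v` and `w`, then one layer of comparators
`z₁ = v₁, z_{2i} = min(v_{i+1}, wᵢ), z_{2i+1} = max(v_{i+1}, wᵢ), z_n = w_m`. On Boolean inputs a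
comparator is the monotone pair `(x ∧ y, x ∨ y)`, so the network is a circuit over `{∧₂, ∨₂}`
with `M(m) = m log m + 1` comparators (Wegener 1987, (2.2)–(2.3); Thm. 2.1, (2.12)).

Everything here is PROVED, in the straight-line model of `Circuit.lean` / the `CktSize` calculus
of `CircuitComposition.lean`, and in *counting (threshold) semantics*: a sorted `0`–`1` vector
of length `L` with `s` ones, listed in decreasing order, is the vector `([j + 1 ≤ s])_{j < L}`,
i.e. the vector of threshold functions `(Th₁, …, Th_L)` of the underlying variables
(cf. `srt` in `NegationLimitedProofs.lean`).

* `CktSize.pi_prod_fin`, `CktSize.blocks` — bundling a `Fin K`-indexed family of multi-output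
  programs, and running `K` re-wired copies of one program (sizes add; Vollmer 1999, §1.2).
* `exists_oddEvenMerge` — **Batcher's merging network**: for every `r` a program over
  `{∧₂, ∨₂}` with at most `(r + 1) · 2^{r+1}` gates mapping the pair of sorted vectors with `a`
  resp. `b` ones (`a, b ≤ 2^r`) to the sorted vector of length `2^{r+1}` with `a + b` ones.
  Correctness as in Wegener's proof (count the ones in the odd and even subsequences:
  `⌈a/2⌉ + ⌈b/2⌉` versus `⌊a/2⌋ + ⌊b/2⌋`, differing by at most `2`).

The network is used for Wegener's pseudo-complement circuit (`SliceFunctionsProofs.lean`,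
`pseudoComplements_cktSize_holds`). NOT here: depth bounds, the sorting network as such
(merge sort level by level is `cktSize_sortBlocks` in `SliceFunctionsProofs.lean`), the
`Ω(n log n)` lower bounds (Wegener 1987, Ch. 6, §4), AKS.

## References
* K. E. Batcher, *Sorting networks and their applications*, AFIPS Spring Joint Computer
  Conference (1968) 307–314 [Batcher1968].
* I. Wegener, *The Complexity of Boolean Functions*, Wiley–Teubner (1987), Ch. 6, §2,
  Algorithm 2.1 and Theorem 2.1 [Wegener1987].
* H. Vollmer, *Introduction to Circuit Complexity* (1999), §1.2 [Vollmer1999].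
-/

namespace Literature.Computability.Complexity

open Finset GateList

variable {ι κ : Type*}

namespace CktSize

variable {B : Set GateFn}

/-- Bundling `K` multi-output programs on the same inputs: sizes add (Vollmer 1999, §1.2).
[folklore] -/
theorem pi_prod_fin {K : ℕ} {f : (ι → Bool) → Fin K × κ → Bool} {s : ℕ}
    (h : ∀ b : Fin K, CktSize B (fun x j => f x (b, j)) s) : CktSize B f (K * s) := by
  induction K with
  | zero =>
    rw [Nat.zero_mul]
    exact of_isEmpty B f
  | succ K ih =>
    have h1 : CktSize B (fun x (q : Fin K × κ) => f x (q.1.castSucc, q.2)) (K * s) :=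
      ih fun b => h b.castSucc
    have h2 := h1.pair (h (Fin.last K))
    rw [Nat.succ_mul]
    refine (h2.outMap fun q : Fin (K + 1) × κ =>
      if hq : (q.1 : ℕ) < K then Sum.inl (⟨q.1, hq⟩, q.2) else Sum.inr q.2).congr fun x q => ?_
    obtain ⟨b, j⟩ := q
    by_cases hq : (b : ℕ) < K
    · simp only [hq, ↓reduceDIte, Sum.elim_inl]
      rfl
    · simp only [hq, ↓reduceDIte, Sum.elim_inr]
      rw [Fin.eq_last_of_not_lt hq]

/-- Applying one program blockwise: `K` copies of a program for `M`, copy `b` reading its inputs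
through the wiring `inw b` (Vollmer 1999, §1.2). [folklore] -/
theorem blocks {α : Type*} {K : ℕ} {M : (α → Bool) → κ → Bool} {s : ℕ} (hM : CktSize B M s)
    (inw : Fin K → α → ι) :
    CktSize B (fun (y : ι → Bool) (q : Fin K × κ) => M (fun j => y (inw q.1 j)) q.2) (K * s) :=
  pi_prod_fin fun b => hM.rewire (inw b)

end CktSize

/-! ### Batcher's odd–even merging network, in threshold (counting) semantics -/

/-- **Batcher's odd–even merging network** (Batcher 1968; Wegener 1987, Ch. 6, Algorithm 2.1.b
and Thm. 2.1, (2.12)): for every `r` there is a straight-line program over `{∧₂, ∨₂}` with at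
most `(r + 1) · 2^{r+1}` gates which, fed with two sorted `0`–`1` vectors of length `2^r` — with
`a` resp. `b` ones in front (`a, b ≤ 2^r`) — outputs the sorted vector of length `2^{r+1}` with
`a + b` ones in front; equivalently, from the threshold vectors `(Th₁, …, Th_{2^r})` of two
disjoint sets of variables it computes the threshold vector `(Th₁, …, Th_{2^{r+1}})` of their
union. Recursion (Algorithm 2.1.b): merge the even-indexed and the odd-indexed subsequences
(`0`-indexed: positions `2j` resp. `2j + 1`) separately into `d` and `e`, then output
`d₀, d₁ ∨ e₀, d₁ ∧ e₀, d₂ ∨ e₁, d₂ ∧ e₁, …, e_{2^r - 1}`; correctness by counting ones,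
`⌈a/2⌉ + ⌈b/2⌉` in `d` versus `⌊a/2⌋ + ⌊b/2⌋` in `e` (Wegener 1987, proof of Alg. 2.1).
[cite: Wegener1987, Ch. 6 §2, Alg. 2.1.b & Thm. 2.1] -/
theorem exists_oddEvenMerge : ∀ r : ℕ,
    ∃ M : (Fin (2 ^ r) ⊕ Fin (2 ^ r) → Bool) → Fin (2 ^ (r + 1)) → Bool,
      CktSize monotoneBasis M ((r + 1) * 2 ^ (r + 1)) ∧
      ∀ (y : Fin (2 ^ r) ⊕ Fin (2 ^ r) → Bool) (a b : ℕ), a ≤ 2 ^ r → b ≤ 2 ^ r →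
        (∀ j : Fin (2 ^ r), y (.inl j) = decide (j.val + 1 ≤ a)) →
        (∀ j : Fin (2 ^ r), y (.inr j) = decide (j.val + 1 ≤ b)) →
        ∀ s : Fin (2 ^ (r + 1)), M y s = decide (s.val + 1 ≤ a + b)
  | 0 => by
    refine ⟨fun y s => if s.val = 0 then (y (.inl 0) || y (.inr 0)) else (y (.inl 0) && y (.inr 0)),
      ?_, ?_⟩
    · have h := (cktSize_or_mono (ι := Fin (2 ^ 0) ⊕ Fin (2 ^ 0)) (.inl 0) (.inr 0)).pair
        (cktSize_and_mono (ι := Fin (2 ^ 0) ⊕ Fin (2 ^ 0)) (.inl 0) (.inr 0))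
      refine ((h.outMap fun s : Fin (2 ^ (0 + 1)) =>
        if s.val = 0 then Sum.inl () else Sum.inr ()).of_le (by norm_num)).congr fun y s => ?_
      by_cases hs : s.val = 0 <;> simp [hs]
    · intro y a b ha hb hya hyb s
      have h0 := hya 0
      have h1 := hyb 0
      simp only [Fin.val_zero, zero_add] at h0 h1
      have hs := s.isLt
      by_cases hs0 : s.val = 0
      · simp only [hs0, ↓reduceIte, h0, h1]
        rw [Bool.eq_iff_iff]
        simp only [Bool.or_eq_true, decide_eq_true_eq]
        omega
      · simp only [hs0, ↓reduceIte, h0, h1]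
        rw [Bool.eq_iff_iff]
        simp only [Bool.and_eq_true, decide_eq_true_eq]
        have : s.val = 1 := by simp at hs; omega
        omega
  | r + 1 => by
    obtain ⟨M, hM, hspec⟩ := exists_oddEvenMerge r
    have hpow : 2 ^ (r + 2) = 2 * 2 ^ (r + 1) := by rw [pow_succ]; ring
    have hpow' : 2 ^ (r + 1) = 2 * 2 ^ r := by rw [pow_succ]; ring
    have hpos : 0 < 2 ^ r := Nat.two_pow_pos r
    -- even / odd subsequences
    obtain ⟨ev, hev1, hev2⟩ : ∃ ev : Fin (2 ^ r) ⊕ Fin (2 ^ r) → Fin (2 ^ (r + 1)) ⊕ Fin (2 ^ (r + 1)),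
        (∀ j, ev (.inl j) = .inl ⟨2 * j.val, by omega⟩) ∧
        (∀ j, ev (.inr j) = .inr ⟨2 * j.val, by omega⟩) :=
      ⟨Sum.map (fun j => ⟨2 * j.val, by omega⟩) (fun j => ⟨2 * j.val, by omega⟩),
        fun _ => rfl, fun _ => rfl⟩
    obtain ⟨od, hod1, hod2⟩ : ∃ od : Fin (2 ^ r) ⊕ Fin (2 ^ r) → Fin (2 ^ (r + 1)) ⊕ Fin (2 ^ (r + 1)),
        (∀ j, od (.inl j) = .inl ⟨2 * j.val + 1, by omega⟩) ∧
        (∀ j, od (.inr j) = .inr ⟨2 * j.val + 1, by omega⟩) :=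
      ⟨Sum.map (fun j => ⟨2 * j.val + 1, by omega⟩) (fun j => ⟨2 * j.val + 1, by omega⟩),
        fun _ => rfl, fun _ => rfl⟩
    -- the final layer of comparators
    obtain ⟨cmb, hcmb⟩ :
        ∃ cmb : (Fin (2 ^ (r + 1)) ⊕ Fin (2 ^ (r + 1)) → Bool) → Fin (2 ^ (r + 2)) → Bool,
          ∀ z s, cmb z s =
            if h0 : s.val = 0 then z (.inl ⟨0, by omega⟩)
            else if hl : s.val = 2 ^ (r + 2) - 1 then z (.inr ⟨2 ^ (r + 1) - 1, by omega⟩)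
            else if s.val % 2 = 1 then
              (z (.inl ⟨(s.val + 1) / 2, by omega⟩) || z (.inr ⟨(s.val - 1) / 2, by omega⟩))
            else (z (.inl ⟨s.val / 2, by omega⟩) && z (.inr ⟨s.val / 2 - 1, by omega⟩)) :=
      ⟨_, fun _ _ => rfl⟩
    refine ⟨fun y => cmb (Sum.elim (M fun i => y (ev i)) (M fun i => y (od i))), ?_, ?_⟩
    · -- size: two half-size mergers and one comparator per output
      have h1 : CktSize monotoneBasis
          (fun y : Fin (2 ^ (r + 1)) ⊕ Fin (2 ^ (r + 1)) → Bool =>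
            Sum.elim (M fun i => y (ev i)) (M fun i => y (od i)))
          ((r + 1) * 2 ^ (r + 1) + (r + 1) * 2 ^ (r + 1)) :=
        (hM.rewire ev).pair (hM.rewire od)
      have h2 : CktSize monotoneBasis cmb (Fintype.card (Fin (2 ^ (r + 2))) * 1) := by
        refine CktSize.pi_const fun s => ?_
        simp only [hcmb]
        by_cases h0 : s.val = 0
        · simp only [h0, ↓reduceDIte]
          exact (CktSize.proj monotoneBasis fun _ : Unit =>
            (Sum.inl ⟨0, by omega⟩ : Fin (2 ^ (r + 1)) ⊕ Fin (2 ^ (r + 1)))).of_le (Nat.zero_le _)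
        · simp only [h0, ↓reduceDIte]
          by_cases hl : s.val = 2 ^ (r + 2) - 1
          · simp only [hl, ↓reduceDIte]
            exact (CktSize.proj monotoneBasis fun _ : Unit =>
              (Sum.inr ⟨2 ^ (r + 1) - 1, by omega⟩ : Fin (2 ^ (r + 1)) ⊕ Fin (2 ^ (r + 1)))).of_le
                (Nat.zero_le _)
          · simp only [hl, ↓reduceDIte]
            by_cases hpar : s.val % 2 = 1
            · simp only [hpar, ↓reduceIte]
              exact cktSize_or_mono _ _
            · simp only [hpar, ↓reduceIte]
              exact cktSize_and_mono _ _
      refine ((h1.comp h2).of_le ?_).congr fun _ _ => rfl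
      simp only [Fintype.card_fin]
      rw [hpow]
      ring_nf
      omega
    · -- correctness on sorted inputs
      intro y a b ha hb hya hyb s
      have hd : ∀ i : Fin (2 ^ (r + 1)), M (fun i => y (ev i)) i =
          decide (i.val + 1 ≤ (a + 1) / 2 + (b + 1) / 2) := by
        refine hspec _ _ _ (by omega) (by omega) (fun j => ?_) (fun j => ?_)
        · rw [hev1, hya]
          simp only [decide_eq_decide]
          omega
        · rw [hev2, hyb]
          simp only [decide_eq_decide]
          omega
      have he : ∀ i : Fin (2 ^ (r + 1)), M (fun i => y (od i)) i =
          decide (i.val + 1 ≤ a / 2 + b / 2) := by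
        refine hspec _ _ _ (by omega) (by omega) (fun j => ?_) (fun j => ?_)
        · rw [hod1, hya]
          simp only [decide_eq_decide]
          omega
        · rw [hod2, hyb]
          simp only [decide_eq_decide]
          omega
      have hs := s.isLt
      show cmb _ s = _
      rw [hcmb]
      by_cases h0 : s.val = 0
      · simp only [h0, ↓reduceDIte, Sum.elim_inl, hd]
        simp only [decide_eq_decide]
        omega
      · simp only [h0, ↓reduceDIte]
        by_cases hl : s.val = 2 ^ (r + 2) - 1
        · simp only [hl, ↓reduceDIte, Sum.elim_inr, he]
          simp only [decide_eq_decide]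
          omega
        · simp only [hl, ↓reduceDIte]
          by_cases hpar : s.val % 2 = 1
          · simp only [hpar, ↓reduceIte, Sum.elim_inl, Sum.elim_inr, hd, he]
            rw [Bool.eq_iff_iff]
            simp only [Bool.or_eq_true, decide_eq_true_eq]
            omega
          · simp only [hpar, ↓reduceIte, Sum.elim_inl, Sum.elim_inr, hd, he]
            rw [Bool.eq_iff_iff]
            simp only [Bool.and_eq_true, decide_eq_true_eq]
            omega


end Literature.Computability.Complexity
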